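import Literature.NumberTheory.Automorphic.UnitaryGroupRogawskiTorusCartanForm
import HarnessLib

/-!
# The quasi-split `U(3)` over a valued field with ANY isometric involution — I: explicit elements, the rank-one BIG CELL
# `u(x,z) = ū(x/z̄, 1/z)·d(z, -z̄/z, z̄⁻¹)·w₀·ū(x/z, 1/z)`, and `K₀ = U ∩ GL₃(𝒪)` by entries

Topic `NumberTheory/Automorphic`; namespace `Literature.NumberTheory.Automorphic.UnitaryGroup`.  THEOREMS ONLY (no `def`, no `instance`,
no notation, no named fact, no `sorry`; axioms ⊆ {propext, Classical.choice, Quot.sound}).  Cell `pub/hodgecm-mathlib` (D-0151), crux `H413`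
(`stmt-HodgeConjecture-24833`), programme P2 (desk F0P2-plan (g8), «=» 2026-08-31T18:06Z), road (δ) «ELEMENTARY CARTAN for ANY
quadratic `σ`»: file 1 of 3 (`UnitaryGroupRankOneBigCell` → `UnitaryGroupRankOneIwasawa` → `UnitaryGroupRankOneCartanAnyInvolution`),
whose head `exists_cartan_of_involution` feeds ★ `isSupercuspidal_of_coinvariants_subsingleton_of_cartan_diagonal` (A-p16, p830719) and
thereby the ⇐ half of the printed citation ★ `Rogawski1990.u3_isSupercuspidal_iff_jacquet_eq_zero` at the RAMIFIED non-split places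
(the unramified ones are ★ p830400).  HONEST LABEL: HC_CM is proved only modulo the printed citations until rung 0 closes; this file is
pure structure theory of `U(σ, Φ₃)(K)` and discharges nothing by itself.

SETTING.  `K` a field, `σ : K →+* K` with `σσ = id` where needed (`hσσ`), `Φ₃ = antidiag(1,1,1)` (★ `StdForm.antidiagonal 3`, passed as
`hJ : J = Φ₃` in the style of ★ `UnitaryGroupBorelInduction`), `U = U(σ, Φ₃)(K)` (★ `unitaryGroupOfForm`), its Borel data `B ⊃ T, N`
(★ `borelU` ∕ `torusU` ∕ `unipotentU`), `w₀ ∈ U` (★ `weylLongU`); in §2–§3 additionally `Valued K ℤᵐ⁰` (+ the `ValuativeRel` bridge of ★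
`UnitaryGroupRogawskiTorusCartanForm`) and `hσv : |σ x| = |x|`, `K₀ = U ∩ GL₃(𝒪) = (glInt 3 K).comap U.subtype`.  NO condition on the
residue characteristic and NO `σ`-fixed uniformiser (ramified quadratic `K/K^σ` included) anywhere in this series.

* §1 `sum_rel_of_mem` (the nine unitarity relations), **`inv_apply_of_mem`** (`(g⁻¹)_{ij} = σ(g_{2-j,2-i})`), `exists_coe_eq_upper_of_mem_unipotentU`
  (`n ∈ N` is `u(x, z) = !![1,x,z; 0,1,-σx; 0,0,1]` with `z + σz + xσx = 0`), the constructors `exists_coe_eq_lower` (`ū(p,q) ∈ U`),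
  `exists_coe_eq_diag` (`d(α, β, (σα)⁻¹) ∈ T`), `exists_coe_eq_scalar_mem_center` (`β·1 ∈ Z(U)`), `coe_coe_weylLongU_three`,
  `weylLongU_mul_weylLongU`, and the **BIG-CELL MATRIX IDENTITY** `upper_eq_lower_mul_diag_mul_weyl_mul_lower`: for `z, z̄ ≠ 0`, `z + z̄ + xy = 0`,
  `!![1,x,z;0,1,-y;0,0,1] = ū(x/z̄,1/z) · d(z,-z̄/z,z̄⁻¹) · w₀ · ū(x/z,1/z)` — the rank-one Bruhat big cell `N ∖ 1 ⊂ N̄ T w₀ N̄` with its coordinates.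
* §2 **`mem_glInt_iff_forall_v_le_one`** (`K₀` is cut out by the ENTRIES of `g` alone, since `g⁻¹ = Φ₃ ᵗ(σg) Φ₃`), `mem_glInt_of_coe_eq`,
  `v_mul_v_le_of_rel` (**`|x|² ≤ |z|`** on `N`, ultrametric, every residue characteristic), `v_le_one_of_rel`, `v_le_v_of_rel`, `mem_glInt_of_coe_eq_lower`.
* §3 torus bookkeeping: `exists_coe_eq_diagonal_of_mem_torusU`, `mul_comm_of_mem_torusU`, `inv_mul_mul_mem_unipotentU` (`t⁻¹ n t ∈ N`).

## References
* [Rogawski1990] J. D. Rogawski, *Automorphic Representations of Unitary Groups in Three Variables*, Ann. of Math. Stud. 123 (1990),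
  §1.9 p. 8 (the form `Φ` and `U(Φ)`), §1.10 p. 9 (`B = MN`, `N = {u(x, z)}`, `M = {d(α, β, ᾱ⁻¹)}`, the Weyl element), §12.2 p. 173.
* [BruhatTits1972] F. Bruhat, J. Tits, *Groupes réductifs sur un corps local I*, Publ. Math. IHÉS 41 (1972), (4.4.3) (Iwasawa and
  Cartan decompositions `G = K·B`, `G = K·A⁺·K` for a good maximal compact `K`).
* [Tits1979] J. Tits, *Reductive groups over local fields*, Proc. Sympos. Pure Math. 33.1 (1979), §3.3.2–§3.3.3.
* [Casselman1995] W. Casselman, *Introduction to the theory of admissible representations of `p`-adic reductive groups* (1995 notes),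
  Prop. 1.3.1 (rank-one Bruhat cells), Thm. 5.3.1 (Harish-Chandra's criterion — the consumer).
* [PlatonovRapinchuk1994] V. Platonov, A. Rapinchuk, *Algebraic Groups and Number Theory* (1994), §3.3 (`GL_n(𝒪)` and its conjugates).
* [Serre1979] J.-P. Serre, *Local Fields*, GTM 67 (1979), Ch. I §1, Ch. II §1 (discrete valuations, uniformisers, the ultrametric inequality).
-/

set_option autoImplicit false

open scoped MatrixGroups Pointwise Topology WithZero
open ValuativeRel Matrix

namespace Literature.NumberTheory.Automorphic

namespace UnitaryGroup

/-! ## §1 Algebra of `U(σ, Φ₃)(K)` over a field: relations, shapes, constructors, the big cell -/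

section Algebra

variable {K : Type*} [Field K] (σ : K →+* K) {J : Matrix (Fin 3) (Fin 3) K} (hJ : J = (StdForm.antidiagonal 3).over K)

/-- `rev 0 = 2` in `Fin 3`. [folklore] -/
private theorem rev0' : Fin.rev (0 : Fin 3) = 2 := rfl

/-- `rev 1 = 1` in `Fin 3`. [folklore] -/
private theorem rev1' : Fin.rev (1 : Fin 3) = 1 := rfl

/-- `rev 2 = 0` in `Fin 3`. [folklore] -/
private theorem rev2' : Fin.rev (2 : Fin 3) = 0 := rfl

/-- `Φ₃ = antidiag(1, 1, 1)` as an explicit matrix. [cite: Rogawski1990, §1.9 p. 8] -/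
theorem antidiagonal_three_over_eq : (StdForm.antidiagonal 3).over K = !![(0 : K), 0, 1; 0, 1, 0; 1, 0, 0] := by
  ext i j
  fin_cases i <;> fin_cases j <;> simp [StdForm.over, Fin.rev]

/-- A `3 × 3` diagonal matrix written out. [folklore] -/
private theorem diagonal_three_eq (p q r : K) : Matrix.diagonal ![p, q, r] = !![p, 0, 0; 0, q, 0; 0, 0, r] := by
  ext i j
  fin_cases i <;> fin_cases j <;> simp

include hJ in
/-- **The nine unitarity relations** `∑ᵢ σ(g_{ia}) g_{2-i, b} = δ_{b, 2-a}` of `g ∈ U(σ, Φ₃)` (★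
`mem_unitaryGroupOfForm_antidiagonal_iff_sum'` at `J = Φ₃`). [cite: Rogawski1990, §1.9 p. 8] -/
theorem sum_rel_of_mem (g : ↥(unitaryGroupOfForm σ J)) (a b : Fin 3) :
    ∑ i, σ (((g : GL (Fin 3) K) : Matrix (Fin 3) (Fin 3) K) i a) * ((g : GL (Fin 3) K) : Matrix (Fin 3) (Fin 3) K) (Fin.rev i) b =
      if b = Fin.rev a then 1 else 0 := by
  have hgU : ((g : ↥(unitaryGroupOfForm σ J)) : GL (Fin 3) K) ∈ unitaryGroupOfForm σ ((StdForm.antidiagonal 3).over K) := by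
    rw [← hJ]; exact g.2
  exact (mem_unitaryGroupOfForm_antidiagonal_iff_sum' σ 3 _).1 hgU a b

include hJ in
/-- **The inverse of a unitary matrix, entrywise**: for `g ∈ U(σ, Φ₃)`, `(g⁻¹)_{ij} = σ(g_{2-j, 2-i})` (`g⁻¹ = Φ₃ ᵗ(σg) Φ₃`).
[cite: Rogawski1990, §1.9 p. 8] -/
theorem inv_apply_of_mem (g : ↥(unitaryGroupOfForm σ J)) (i j : Fin 3) :
    (((g : GL (Fin 3) K)⁻¹ : GL (Fin 3) K) : Matrix (Fin 3) (Fin 3) K) i j =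
      σ ((((g : GL (Fin 3) K) : Matrix (Fin 3) (Fin 3) K)) (Fin.rev j) (Fin.rev i)) := by
  have key : (Matrix.of fun i j => σ ((((g : GL (Fin 3) K) : Matrix (Fin 3) (Fin 3) K)) (Fin.rev j) (Fin.rev i))) *
      ((g : GL (Fin 3) K) : Matrix (Fin 3) (Fin 3) K) = 1 := by
    ext a b
    rw [Matrix.mul_apply, ← Equiv.sum_comp Fin.revPerm]
    simp only [Matrix.of_apply, Fin.revPerm_apply, Fin.rev_rev]
    rw [sum_rel_of_mem σ hJ g (Fin.rev a) b, Fin.rev_rev, Matrix.one_apply]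
    by_cases hab : a = b
    · rw [if_pos hab, if_pos hab.symm]
    · rw [if_neg hab, if_neg (Ne.symm hab)]
  rw [Matrix.coe_units_inv, Matrix.inv_eq_left_inv key, Matrix.of_apply]

include hJ in
/-- **The shape of a unipotent element**: `n ∈ N` has matrix `u(x, z) = !![1, x, z; 0, 1, -σ x; 0, 0, 1]` with
`z + σ z + x σ x = 0`. [cite: Rogawski1990, §1.10 p. 9] -/
theorem exists_coe_eq_upper_of_mem_unipotentU (hσσ : ∀ x, σ (σ x) = x) {n : ↥(unitaryGroupOfForm σ J)} (hn : n ∈ unipotentU σ J) :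
    ∃ x z : K, ((n : GL (Fin 3) K) : Matrix (Fin 3) (Fin 3) K) = !![1, x, z; 0, 1, -σ x; 0, 0, 1] ∧ z + σ z + x * σ x = 0 := by
  obtain ⟨htri, hdiag⟩ := (mem_unipotentU_iff n).1 hn
  have h10 : ((n : GL (Fin 3) K) : Matrix (Fin 3) (Fin 3) K) 1 0 = 0 := htri (by decide)
  have h20 : ((n : GL (Fin 3) K) : Matrix (Fin 3) (Fin 3) K) 2 0 = 0 := htri (by decide)
  have h21 : ((n : GL (Fin 3) K) : Matrix (Fin 3) (Fin 3) K) 2 1 = 0 := htri (by decide)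
  have h00 := hdiag 0
  have h11 := hdiag 1
  have h22 := hdiag 2
  have r12 := sum_rel_of_mem σ hJ n 1 2
  have r22 := sum_rel_of_mem σ hJ n 2 2
  simp only [Fin.sum_univ_three, rev0', rev1', rev2'] at r12 r22
  rw [h22, h11, h21] at r12
  rw [h22] at r22
  simp only [map_one, one_mul, map_zero, zero_mul, add_zero, mul_one] at r12 r22
  refine ⟨((n : GL (Fin 3) K) : Matrix (Fin 3) (Fin 3) K) 0 1, ((n : GL (Fin 3) K) : Matrix (Fin 3) (Fin 3) K) 0 2, ?_, ?_⟩
  · ext i j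
    fin_cases i <;> fin_cases j <;> simp [h00, h11, h22, h10, h20, h21]
    · -- entry (1,2) = -σ x
      have : ((n : GL (Fin 3) K) : Matrix (Fin 3) (Fin 3) K) 1 2 = -σ (((n : GL (Fin 3) K) : Matrix (Fin 3) (Fin 3) K) 0 1) := by
        have h : σ (((n : GL (Fin 3) K) : Matrix (Fin 3) (Fin 3) K) 0 1) + ((n : GL (Fin 3) K) : Matrix (Fin 3) (Fin 3) K) 1 2 = 0 := by
          simpa using r12
        linear_combination h
      exact this
  · -- the relation from (2,2): uses `n₁₂ = -σ n₀₁` and `σσ = id`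
    have h12 : ((n : GL (Fin 3) K) : Matrix (Fin 3) (Fin 3) K) 1 2 = -σ (((n : GL (Fin 3) K) : Matrix (Fin 3) (Fin 3) K) 0 1) := by
      have h : σ (((n : GL (Fin 3) K) : Matrix (Fin 3) (Fin 3) K) 0 1) + ((n : GL (Fin 3) K) : Matrix (Fin 3) (Fin 3) K) 1 2 = 0 := by
        simpa using r12
      linear_combination h
    rw [h12, map_neg, hσσ] at r22
    have h := r22
    simp only [if_false, show ¬ ((2 : Fin 3) = 0) from by decide] at h
    linear_combination h

include hJ in
/-- **Lower unitriangular unitary elements** `ū(p, q) = !![1, 0, 0; -σ p, 1, 0; q, p, 1]` (`= w₀ u(p, q) w₀`): in `U(σ, Φ₃)` as soon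
as `q + σ q + p σ p = 0`. [cite: Rogawski1990, §1.10 p. 9] -/
theorem exists_coe_eq_lower (hσσ : ∀ x, σ (σ x) = x) {p q : K} (hrel : q + σ q + p * σ p = 0) :
    ∃ k : ↥(unitaryGroupOfForm σ J), ((k : GL (Fin 3) K) : Matrix (Fin 3) (Fin 3) K) = !![1, 0, 0; -σ p, 1, 0; q, p, 1] := by
  have hdet : (!![(1 : K), 0, 0; -σ p, 1, 0; q, p, 1] : Matrix (Fin 3) (Fin 3) K).det ≠ 0 := by
    rw [Matrix.det_fin_three]; simp
  have hmem : Matrix.GeneralLinearGroup.mkOfDetNeZero _ hdet ∈ unitaryGroupOfForm σ J := by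
    rw [hJ, mem_unitaryGroupOfForm_antidiagonal_iff_sum']
    intro a b
    fin_cases a <;> fin_cases b <;>
      simp [Fin.sum_univ_three, rev1', rev2', Matrix.GeneralLinearGroup.val_mkOfDetNeZero, map_neg, hσσ]
    · linear_combination hrel
  exact ⟨⟨_, hmem⟩, Matrix.GeneralLinearGroup.val_mkOfDetNeZero _ _⟩

include hJ in
/-- **Diagonal unitary elements** `d(α, β, (σα)⁻¹)` (Rogawski's torus `M`): in `U(σ, Φ₃)` and in `T` as soon as `α ≠ 0` and
`σ β · β = 1`. [cite: Rogawski1990, §1.10 p. 9] -/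
theorem exists_coe_eq_diag (hσσ : ∀ x, σ (σ x) = x) {α β : K} (hα : α ≠ 0) (hβ : σ β * β = 1) :
    ∃ t : ↥(unitaryGroupOfForm σ J), t ∈ torusU σ J ∧ ((t : GL (Fin 3) K) : Matrix (Fin 3) (Fin 3) K) = !![α, 0, 0; 0, β, 0; 0, 0, (σ α)⁻¹] := by
  have hβ0 : β ≠ 0 := fun h => by rw [h, mul_zero] at hβ; exact zero_ne_one hβ
  have hσα : σ α ≠ 0 := (map_ne_zero σ).2 hα
  set d : Fin 3 → Kˣ := ![Units.mk0 α hα, Units.mk0 β hβ0, (Units.mk0 (σ α) hσα)⁻¹] with hd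
  have hdU : glDiagonal 3 K d ∈ unitaryGroupOfForm σ J := by
    rw [hJ, glDiagonal_mem_unitaryGroupOfForm_antidiagonal_iff]
    intro i
    fin_cases i
    · show σ ((d 2 : Kˣ) : K) * ((d 0 : Kˣ) : K) = 1
      simp [hd, map_inv₀, hσσ, inv_mul_cancel₀ hα]
    · show σ ((d 1 : Kˣ) : K) * ((d 1 : Kˣ) : K) = 1
      simpa [hd] using hβ
    · show σ ((d 0 : Kˣ) : K) * ((d 2 : Kˣ) : K) = 1
      simp [hd, mul_inv_cancel₀ hσα]
  refine ⟨⟨glDiagonal 3 K d, hdU⟩, ⟨d, rfl⟩, ?_⟩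
  show ((glDiagonal 3 K d : GL (Fin 3) K) : Matrix (Fin 3) (Fin 3) K) = _
  rw [coe_glDiagonal]
  ext i j
  fin_cases i <;> fin_cases j <;> simp [hd]

include hJ in
/-- **Central unitary elements**: a scalar `β · 1` with `σ β · β = 1` lies in `U(σ, Φ₃)`, in `T`, and in the centre.
[cite: Rogawski1990, §1.10 p. 9] -/
theorem exists_coe_eq_scalar_mem_center (hσσ : ∀ x, σ (σ x) = x) {β : K} (hβ : σ β * β = 1) :
    ∃ z : ↥(unitaryGroupOfForm σ J), z ∈ Subgroup.center ↥(unitaryGroupOfForm σ J) ∧ z ∈ torusU σ J ∧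
      ((z : GL (Fin 3) K) : Matrix (Fin 3) (Fin 3) K) = !![β, 0, 0; 0, β, 0; 0, 0, β] := by
  have hβ0 : β ≠ 0 := fun h => by rw [h, mul_zero] at hβ; exact zero_ne_one hβ
  have hσβ : (σ β)⁻¹ = β := inv_eq_of_mul_eq_one_right hβ
  obtain ⟨z, hzT, hz⟩ := exists_coe_eq_diag σ hJ hσσ hβ0 hβ
  rw [hσβ] at hz
  refine ⟨z, ?_, hzT, hz⟩
  rw [Subgroup.mem_center_iff]
  intro g
  have hsc : ((z : GL (Fin 3) K) : Matrix (Fin 3) (Fin 3) K) = β • (1 : Matrix (Fin 3) (Fin 3) K) := by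
    rw [hz]; ext i j; fin_cases i <;> fin_cases j <;> simp
  apply Subtype.ext
  apply Units.ext
  change ((g : GL (Fin 3) K) : Matrix (Fin 3) (Fin 3) K) * ((z : GL (Fin 3) K) : Matrix (Fin 3) (Fin 3) K) =
    ((z : GL (Fin 3) K) : Matrix (Fin 3) (Fin 3) K) * ((g : GL (Fin 3) K) : Matrix (Fin 3) (Fin 3) K)
  rw [hsc, Matrix.mul_smul, Matrix.smul_mul, Matrix.mul_one, Matrix.one_mul]

/-- The long Weyl element `w₀ ∈ U(σ, Φ₃)` (★ `weylLongU`) has matrix `antidiag(1, 1, 1)`. [cite: Rogawski1990, §1.10 p. 9] -/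
theorem coe_coe_weylLongU_three : (((weylLongU σ hJ : ↥(unitaryGroupOfForm σ J)) : GL (Fin 3) K) : Matrix (Fin 3) (Fin 3) K) =
    !![(0 : K), 0, 1; 0, 1, 0; 1, 0, 0] := by
  rw [coe_coe_weylLongU, hJ, antidiagonal_three_over_eq]

/-- `w₀ w₀ = 1`. [cite: Rogawski1990, §1.10 p. 9] -/
theorem weylLongU_mul_weylLongU : weylLongU σ hJ * weylLongU σ hJ = 1 := by
  apply Subtype.ext
  apply Units.ext
  change (((weylLongU σ hJ : ↥(unitaryGroupOfForm σ J)) : GL (Fin 3) K) : Matrix (Fin 3) (Fin 3) K) *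
    (((weylLongU σ hJ : ↥(unitaryGroupOfForm σ J)) : GL (Fin 3) K) : Matrix (Fin 3) (Fin 3) K) = 1
  rw [coe_coe_weylLongU_three]
  ext i j; fin_cases i <;> fin_cases j <;> simp

omit hJ in
/-- **THE RANK-ONE BIG-CELL IDENTITY (matrix form).**  For `z ≠ 0`, `z̄ ≠ 0` and `z + z̄ + x y = 0` (think `y = σ x`, `z̄ = σ z`):
`u(x, z) = ū(x/z̄, 1/z) · d(z, -z̄/z, z̄⁻¹) · w₀ · ū(x/z, 1/z)`, all four factors explicit.  This is the Bruhat big cell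
`N ∖ {1} ⊂ N̄ T w₀ N̄` of the rank-one group made quantitative. [cite: Rogawski1990, §1.10 p. 9] [cite: Casselman1995, Prop. 1.3.1] -/
theorem upper_eq_lower_mul_diag_mul_weyl_mul_lower (x y z zb : K) (hz : z ≠ 0) (hzb : zb ≠ 0) (hrel : z + zb + x * y = 0) :
    (!![1, x, z; 0, 1, -y; 0, 0, 1] : Matrix (Fin 3) (Fin 3) K) =
      !![1, 0, 0; -(y * z⁻¹), 1, 0; z⁻¹, x * zb⁻¹, 1] * !![z, 0, 0; 0, -(zb * z⁻¹), 0; 0, 0, zb⁻¹] * !![(0 : K), 0, 1; 0, 1, 0; 1, 0, 0] *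
        !![1, 0, 0; -(y * zb⁻¹), 1, 0; z⁻¹, x * z⁻¹, 1] := by
  have hzb' : zb = -z - x * y := by linear_combination hrel
  ext i j
  fin_cases i <;> fin_cases j <;> simp [Matrix.mul_apply, Fin.sum_univ_three] <;> field_simp <;> ring_nf <;>
    first | rfl | (subst hzb'; ring)

end Algebra

/-! ## §2 Valuations: `K₀ = U ∩ GL₃(𝒪)` by entries, and the size of unipotent coordinates -/

section Valuation

variable {K : Type*} [Field K] [Valued K ℤᵐ⁰] [ValuativeRel K] [(Valued.v : Valuation K ℤᵐ⁰).Compatible]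
  (σ : K →+* K) {J : Matrix (Fin 3) (Fin 3) K} (hJ : J = (StdForm.antidiagonal 3).over K)

include hJ in
/-- **`K₀ = U ∩ GL₃(𝒪)` is cut out by the entries alone**: for `g ∈ U(σ, Φ₃)` with `σ` isometric, `g ∈ GL₃(𝒪)` iff every
ENTRY of `g` is integral — the inverse is `Φ₃ ᵗ(σg) Φ₃`, whose entries are `σ` of entries of `g` (`inv_apply_of_mem`).
[cite: PlatonovRapinchuk1994, §3.3] [cite: Rogawski1990, §1.9 p. 8] -/
theorem mem_glInt_iff_forall_v_le_one (hσv : ∀ x, Valued.v (σ x) = Valued.v x) (g : ↥(unitaryGroupOfForm σ J)) :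
    (g : GL (Fin 3) K) ∈ glInt 3 K ↔ ∀ i j, Valued.v (((g : GL (Fin 3) K) : Matrix (Fin 3) (Fin 3) K) i j) ≤ 1 := by
  constructor
  · intro h i j
    exact (v_le_one_iff_valuation_le_one _).2 ((Valuation.mem_integer_iff _ _).1 (((mem_glInt_iff _).1 h).1 i j))
  · intro h
    refine mem_glInt_of_forall_valuation_le_one (fun i j => (v_le_one_iff_valuation_le_one _).1 (h i j)) fun i j => ?_
    refine (v_le_one_iff_valuation_le_one _).1 ?_
    rw [inv_apply_of_mem σ hJ g i j, hσv]
    exact h _ _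

include hJ in
/-- Matrix form of `mem_glInt_iff_forall_v_le_one`: a unitary `k` whose matrix is `M` with all `|M_{ij}| ≤ 1` lies in `K₀`.
[cite: PlatonovRapinchuk1994, §3.3] -/
theorem mem_glInt_of_coe_eq (hσv : ∀ x, Valued.v (σ x) = Valued.v x) {k : ↥(unitaryGroupOfForm σ J)} {M : Matrix (Fin 3) (Fin 3) K}
    (hk : ((k : GL (Fin 3) K) : Matrix (Fin 3) (Fin 3) K) = M) (hM : ∀ i j, Valued.v (M i j) ≤ 1) : (k : GL (Fin 3) K) ∈ glInt 3 K := by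
  rw [mem_glInt_iff_forall_v_le_one σ hJ hσv]
  intro i j
  rw [hk]
  exact hM i j

omit [ValuativeRel K] [(Valued.v : Valuation K ℤᵐ⁰).Compatible] in
/-- **`|x|² ≤ |z|` on `N`**: if `z + σ z + x σ x = 0` then `v(x)·v(x) ≤ v(z)` (ultrametric inequality; no restriction on the
residue characteristic). [cite: Rogawski1990, §1.10 p. 9] [cite: Serre1979, Ch. II §1] -/
theorem v_mul_v_le_of_rel (hσv : ∀ x, Valued.v (σ x) = Valued.v x) {x z : K} (hrel : z + σ z + x * σ x = 0) :
    Valued.v x * Valued.v x ≤ Valued.v z := by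
  have h : x * σ x = -(z + σ z) := by linear_combination hrel
  calc Valued.v x * Valued.v x = Valued.v (x * σ x) := by rw [map_mul, hσv]
    _ = Valued.v (z + σ z) := by rw [h, Valuation.map_neg]
    _ ≤ max (Valued.v z) (Valued.v (σ z)) := Valuation.map_add _ _ _
    _ = Valued.v z := by rw [hσv, max_self]

omit [ValuativeRel K] [(Valued.v : Valuation K ℤᵐ⁰).Compatible] in
/-- If `z + σ z + x σ x = 0` and `|z| ≤ 1` then `|x| ≤ 1`. [cite: Rogawski1990, §1.10 p. 9] [cite: Serre1979, Ch. II §1] -/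
theorem v_le_one_of_rel (hσv : ∀ x, Valued.v (σ x) = Valued.v x) {x z : K} (hrel : z + σ z + x * σ x = 0)
    (hz : Valued.v z ≤ 1) : Valued.v x ≤ 1 := by
  by_contra hx
  rw [not_le] at hx
  have h1 : Valued.v x * 1 ≤ Valued.v x * Valued.v x := mul_le_mul_right hx.le _
  rw [mul_one] at h1
  exact absurd (lt_of_lt_of_le hx (h1.trans ((v_mul_v_le_of_rel σ hσv hrel).trans hz))) (lt_irrefl _)

omit [ValuativeRel K] [(Valued.v : Valuation K ℤᵐ⁰).Compatible] in
/-- If `z + σ z + x σ x = 0` and `|z| > 1` then `|x| ≤ |z|` (so `x/z`, `x/σz` are integral). [cite: Rogawski1990, §1.10 p. 9]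
[cite: Serre1979, Ch. II §1] -/
theorem v_le_v_of_rel (hσv : ∀ x, Valued.v (σ x) = Valued.v x) {x z : K} (hrel : z + σ z + x * σ x = 0)
    (hz : 1 < Valued.v z) : Valued.v x ≤ Valued.v z := by
  by_contra hx
  rw [not_le] at hx
  have hx1 : 1 ≤ Valued.v x := (hz.trans hx).le
  have h1 : Valued.v x * 1 ≤ Valued.v x * Valued.v x := mul_le_mul_right hx1 _
  rw [mul_one] at h1
  exact absurd (lt_of_lt_of_le hx (h1.trans (v_mul_v_le_of_rel σ hσv hrel))) (lt_irrefl _)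

include hJ in
/-- An integral lower unitriangular unitary element lies in `K₀`. [cite: PlatonovRapinchuk1994, §3.3] -/
theorem mem_glInt_of_coe_eq_lower (hσv : ∀ x, Valued.v (σ x) = Valued.v x) {k : ↥(unitaryGroupOfForm σ J)} {p q : K}
    (hk : ((k : GL (Fin 3) K) : Matrix (Fin 3) (Fin 3) K) = !![1, 0, 0; -σ p, 1, 0; q, p, 1]) (hp : Valued.v p ≤ 1)
    (hq : Valued.v q ≤ 1) : (k : GL (Fin 3) K) ∈ glInt 3 K := by
  refine mem_glInt_of_coe_eq σ hJ hσv hk fun i j => ?_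
  fin_cases i <;> fin_cases j <;> simp [Valuation.map_neg, hσv, hp, hq]

end Valuation

/-! ## §3 Torus bookkeeping: shape of `t ∈ T`, commutativity, `t⁻¹ N t ⊆ N` -/

section Torus

variable {K : Type*} [Field K] (σ : K →+* K) {J : Matrix (Fin 3) (Fin 3) K} (hJ : J = (StdForm.antidiagonal 3).over K)

include hJ in
/-- **The shape of a torus element**: `t ∈ T` is `diag(d₀, d₁, d₂)` with `σd₂ d₀ = σd₁ d₁ = σd₀ d₂ = 1`.
[cite: Rogawski1990, §1.10 p. 9] -/
theorem exists_coe_eq_diagonal_of_mem_torusU {t : ↥(unitaryGroupOfForm σ J)} (ht : t ∈ torusU σ J) :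
    ∃ d : Fin 3 → Kˣ, ((t : GL (Fin 3) K) : Matrix (Fin 3) (Fin 3) K) = Matrix.diagonal (fun i => (d i : K)) ∧
      σ (d 2 : K) * d 0 = 1 ∧ σ (d 1 : K) * d 1 = 1 ∧ σ (d 0 : K) * d 2 = 1 := by
  obtain ⟨d, hd⟩ := (mem_torusU_iff t).1 ht
  have htU : glDiagonal 3 K d ∈ unitaryGroupOfForm σ ((StdForm.antidiagonal 3).over K) := by
    rw [hd, ← hJ]; exact t.2
  have hrel := (glDiagonal_mem_unitaryGroupOfForm_antidiagonal_iff σ 3 d).1 htU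
  exact ⟨d, by rw [← hd, coe_glDiagonal], hrel 0, hrel 1, hrel 2⟩

/-- `T` is commutative. [cite: Rogawski1990, §1.10 p. 9] -/
theorem mul_comm_of_mem_torusU {t₁ t₂ : ↥(unitaryGroupOfForm σ J)} (h₁ : t₁ ∈ torusU σ J) (h₂ : t₂ ∈ torusU σ J) :
    t₁ * t₂ = t₂ * t₁ := by
  obtain ⟨d₁, hd₁⟩ := (mem_torusU_iff t₁).1 h₁
  obtain ⟨d₂, hd₂⟩ := (mem_torusU_iff t₂).1 h₂
  apply Subtype.ext
  rw [Subgroup.coe_mul, Subgroup.coe_mul, ← hd₁, ← hd₂, ← map_mul, ← map_mul, mul_comm]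

include hJ in
/-- `N` is normalised by `T`: `t⁻¹ n t ∈ N`. [cite: Rogawski1990, §1.10 p. 9] -/
theorem inv_mul_mul_mem_unipotentU {t n : ↥(unitaryGroupOfForm σ J)} (ht : t ∈ torusU σ J) (hn : n ∈ unipotentU σ J) :
    t⁻¹ * n * t ∈ unipotentU σ J := by
  have h : t⁻¹ * n * t⁻¹⁻¹ ∈ (borelTriple σ J hJ).N :=
    (borelTriple σ J hJ).normal_subgroupOf.conj_mem ⟨n, (borelTriple σ J hJ).N_le hn⟩ hn
      ⟨t⁻¹, (borelTriple σ J hJ).M_le (Subgroup.inv_mem _ ht)⟩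
  rwa [inv_inv] at h


end Torus

end UnitaryGroup

end Literature.NumberTheory.Automorphic
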